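import Literature.MathematicalPhysics.QuantumFieldTheory.Balaban1983to89.B11Eq98W80Composite

/-!
# `Balaban1983to89.B11Eq98W80TwoBackgroundLetters` — T. Bałaban, *The variational problem and background fields in renormalization group method for lattice gauge
# theories*, Commun. Math. Phys. **102** (1985) 277–309 [Balaban1985Variational] Prop. 4 (97)–(98) pp. 292–293 («The constants a₃, C₄ depend on d and L only»),
# (84)–(90) pp. 290–291, Prop. 6 (117)–(121) p. 295, with [Balaban1985BackgroundPropagators] Thm 3.4 p. 400: **THE BACKGROUND MODULUS OF `W = (δ/δA′)V` ACROSS TWO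
# CARRIERS (115), TYPED THROUGH KERNEL-COLUMN AND COMPOSITE LETTERS ONLY** — `‖W80(…₁)(P₁) − W80(…₂)(P₂)‖₍₋₃₎` for a pair of configurations with the SAME bond function
# (`flat115 P₂ = flat115 P₁`; `P₂ = ιP₁` in the consumers) bounded GROUP BY GROUP by: the two letters `‖J₁‖, ‖J₂‖` (W₁), the two-background letter `δN` of the COMPOSITE
# `Δπ∘H` and the value modulus `δ_CT` of `C∘T` (row `Δ_π HD(A′)`), the two-background COMPOSITE column letter `δθ′` of `Δπ∘(HD)′` (transposed W₂-row, both `Δπ`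
# (27)-symmetric), the two-background kernel-column letter `δθ_E` of `(HD)′` (W₃ and the V₀-group's `(T′)ᵗ`), the value modulus `δ_VT` of the V₀-current along the two
# Sect. C maps — NO operator norm `‖Δπ‖`, NO generic column constant `κ(‖N‖)` (both ill-posed lattice-free: NE9 leaf-01 memos `LOCATED-after-g97.md` §2 (E′),
# `ROUTE-Jprime-FACE-g104.md` §F3bis); the fixed-lattice twin is ne9-leaf-05's `B11Eq80CurrentTwoCarriers` ∕ `B11Eq98W80BackgroundModulus`

statement-level skeleton of published theorems with citation tags; proofs where landed; nothing here is a claim about the Yang–Mills mass gap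

CITATION HEADER (lean-in-tree rule).  Audit cell `pub-balaban`, sub-cell `t4`, BINDER row NE9; filed by NE9 crux-team LEAF PROVER 01 (`b2b-balaban-t4-ne9-formalise-leaf-01`,
gen 105; ROUTE (J′), the `δ_W` brick of the Support face `NE9CurChartTowerPiLipschitzAtFlatLatticeUniformC`; bears_on: R4/N22).  Composition BY NAME: ne9-leaf-05's
`B11Eq80Current` (`W80 = W1 + W2 + W3 + curV0full`), `B11Eq98CurrentSlot.norm_W1_le`, `B11Eq90V0GroupComposed.{curV0full_apply, fderiv_T47, colSum_kernel_fderiv_T47_le}`,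
`B11Eq90Transpose.{kernel, colFun, transCur, norm_transCur_le}`; this lineage's `B11Eq98W80Composite.norm_Δπ_Emap_le`, `B11Eq88TransposeComposite.colFun_apply_of_symm`.
Source READ first-hand in the held text layer `paper:balaban1985-cmp102-variational-background` (journal page = PDF page + 276) pp. 290–295.  NOTHING of print's proofs
is reproduced: [folklore] (85)–(90) algebra across two carriers.

WHAT IS PROVED (sorry-free; proof lane — 0 `def`; [folklore]).  §1 `colFun_sub_apply`, **`norm_transCur_sub_transCur_le_of_kernel`** (`‖M₁ᵗK − M₂ᵗK‖₍₋₃₎ ≤ ‖ρ‖‖τ‖Θ‖K‖`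
from the weighted column letter of the KERNEL DIFFERENCE), **`norm_transCur_symm_sub_le`** (`‖M₁ᵗ(Δπ₁P₁) − M₂ᵗ(Δπ₂P₂)‖₍₋₃₎ ≤ ‖ρ‖‖τ‖Θ′‖P₁‖` from the column letter of
the COMPOSITE difference), `kernel_neg`, `kernel_fderiv_T47_sub`.  §2 the four groups at a pair `(P₁, P₂)`: **`norm_W1_sub_W1_le`**, `norm_ΔπEmap_sub_le`, **`norm_W2_sub_W2_le`**,
**`norm_W3_sub_W3_le`**, **`norm_curV0full_sub_curV0full_le`**, and the sum **`norm_W80_sub_W80_le_pair`**, every letter displayed.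
HONEST SCOPE.  Mechanism only (the lattice-free suppliers of the letters are this lineage's next files); nothing of [B11] Prop. 4 ∕ (98) ∕ Prop. 6 or [B9] Thm 3.4 asserted
as printed; «NE9 ⇐ the named binders»; NE9 NOT PRINTED ∕ NOT PROVED; spine PROVED 0∕9; rung (B)+1 finite T⁴ — NOT infinite volume, NOT mass gap, NOT BetaPertH, NOT Clay.
HONEST DEPENDENCY: continuum YM on T⁴ ⇐ BetaPertH ∧ nine spine estimates (0/9 proved); BetaPertH ⇐ (D1) ∧ (D4) ∧ CAP+tail; G-an2-4 gates asym, D1 and NE2/3/4.  NEW file;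
nothing modified.  Net new unproved facts: 0.
-/

noncomputable section

open NormedSpace Complex Metric Set Finset Filter Topology

namespace Literature.MathematicalPhysics.QuantumFieldTheory.Balaban1983to89.B11Eq98W80TwoBackgroundLetters

open Literature.MathematicalPhysics.QuantumFieldTheory.Balaban1983to89.B11Prop6Scheme (Prop4Hyp)
open Literature.MathematicalPhysics.QuantumFieldTheory.Balaban1983to89.B11Eq174Chart (solA Regime)
open Literature.MathematicalPhysics.QuantumFieldTheory.Balaban1983to89.B11Eq90V0primeCurrent (flat115 flat115_apply)
open Literature.MathematicalPhysics.QuantumFieldTheory.Balaban1983to89.B11Eq63V0GroupCurrent (curV0)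
open Literature.MathematicalPhysics.QuantumFieldTheory.Balaban1983to89.B11Eq90Transpose
open Literature.MathematicalPhysics.QuantumFieldTheory.Balaban1983to89.B11Eq90V0GroupComposed
open Literature.MathematicalPhysics.QuantumFieldTheory.Balaban1983to89.B11Eq80Current
open Literature.MathematicalPhysics.QuantumFieldTheory.Balaban1983to89.B11Eq98CurrentSlot (norm_W1_le)
open Literature.MathematicalPhysics.QuantumFieldTheory.Balaban1983to89.B11Eq98W80Composite (norm_Δπ_Emap_le)
open Literature.MathematicalPhysics.QuantumFieldTheory.Balaban1983to89.B11Eq88TransposeComposite (colFun_apply_of_symm)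
open B9SectCLatticeCarrier (Bond)
open B11Eq115Space

variable {𝔸 : Type*} [NormedRing 𝔸] [NormedAlgebra ℂ 𝔸] [FiniteDimensional ℂ 𝔸]
variable {d : ℕ} {Pd : Fin d → ℕ} {L η : ℝ} [Fact (0 < L)] [Fact (0 < η)] {lev₀ : Bond d Pd → ℕ} {κ' : Type*} [Fintype κ']
  {lev₁ : κ' → ℕ} {Dc₁ Dc₂ : (Bond d Pd → 𝔸) →ₗ[ℂ] (κ' → 𝔸)}

/-! ## §1 Transposes across two carriers through the kernel difference and through the composite difference -/

section Transpose

/-- The difference of the one-bond functionals of two operators (one per carrier) against the same current is the functional of the KERNEL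
DIFFERENCE: `(ℓ¹_b − ℓ²_b)(X) = Σ_{b′} τ(K(b′)·(k_{M₁}(b′, b) − k_{M₂}(b′, b))X)`. [cite: Balaban1985Variational, (85) p.291, (63) p.287] -/
theorem colFun_sub_apply (τ : 𝔸 →L[ℂ] ℂ) (M₁ : Space115 L η lev₀ lev₁ Dc₁ →L[ℂ] Space115 L η lev₀ lev₁ Dc₁)
    (M₂ : Space115 L η lev₀ lev₁ Dc₂ →L[ℂ] Space115 L η lev₀ lev₁ Dc₂) (K : NegSize L η lev₀ 3 𝔸) (b : Bond d Pd) (X : 𝔸) :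
    colFun τ M₁ K b X - colFun τ M₂ K b X =
      ∑ b' : Bond d Pd, τ (NegSup.equiv (levWeight L η lev₀ 3) 𝔸 K b' * ((kernel M₁ b' b - kernel M₂ b' b) X)) := by
  rw [colFun_apply, colFun_apply, ← Finset.sum_sub_distrib]
  refine Finset.sum_congr rfl fun b' _ => ?_
  rw [← map_sub, ← mul_sub, sub_apply, kernel_apply, kernel_apply]

/-- **`‖M₁ᵗK − M₂ᵗK‖₍₋₃₎ ≤ ‖ρ‖‖τ‖·Θ·‖K‖₍₋₃₎` THROUGH THE WEIGHTED COLUMN LETTER OF THE KERNEL DIFFERENCE** — `M_i` an operator of the `i`-th carrier (115)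
(the kernels `k_{M_i}(b′, b) : 𝔸 →L 𝔸` live on the common fibre), `Σ_{b′}(w₃(b)/w₃(b′))‖k_{M₁}(b′, b) − k_{M₂}(b′, b)‖ ≤ Θ`: the two-background twin of
`B11Eq90Transpose.norm_transCur_le`, with NO operator norm and NO lattice count. [cite: Balaban1985Variational, (86) p.291, (89)–(90) p.291] -/
theorem norm_transCur_sub_transCur_le_of_kernel (ρ : (𝔸 →L[ℂ] ℂ) →L[ℂ] 𝔸) (τ : 𝔸 →L[ℂ] ℂ)
    (M₁ : Space115 L η lev₀ lev₁ Dc₁ →L[ℂ] Space115 L η lev₀ lev₁ Dc₁) (M₂ : Space115 L η lev₀ lev₁ Dc₂ →L[ℂ] Space115 L η lev₀ lev₁ Dc₂)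
    {Θ : ℝ} (hΘ0 : 0 ≤ Θ)
    (hΘ : ∀ b : Bond d Pd, ∑ b' : Bond d Pd, levWeight L η lev₀ 3 b / levWeight L η lev₀ 3 b' * ‖kernel M₁ b' b - kernel M₂ b' b‖ ≤ Θ)
    (K : NegSize L η lev₀ 3 𝔸) : ‖transCur ρ τ M₁ K - transCur ρ τ M₂ K‖ ≤ ‖ρ‖ * ‖τ‖ * Θ * ‖K‖ := by
  rw [NegSup.norm_le_iff (by positivity)]
  intro b
  have hw : ∀ b : Bond d Pd, 0 < levWeight L η lev₀ 3 b := levWeight_pos (Fact.out : 0 < L) (Fact.out : 0 < η) lev₀ 3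
  have hKb : ∀ b' : Bond d Pd, ‖NegSup.equiv (levWeight L η lev₀ 3) 𝔸 K b'‖ ≤ ‖K‖ / levWeight L η lev₀ 3 b' := fun b' => by
    rw [le_div_iff₀ (hw b'), mul_comm]; exact NegSup.weight_mul_norm_apply_le K b'
  have hcol : ‖colFun τ M₁ K b - colFun τ M₂ K b‖ ≤
      ∑ b' : Bond d Pd, ‖τ‖ * ‖NegSup.equiv (levWeight L η lev₀ 3) 𝔸 K b'‖ * ‖kernel M₁ b' b - kernel M₂ b' b‖ := by
    refine ContinuousLinearMap.opNorm_le_bound _ (Finset.sum_nonneg fun _ _ => by positivity) fun X => ?_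
    rw [sub_apply, colFun_sub_apply, Finset.sum_mul]
    refine (norm_sum_le _ _).trans (Finset.sum_le_sum fun b' _ => ?_)
    calc ‖τ (NegSup.equiv (levWeight L η lev₀ 3) 𝔸 K b' * ((kernel M₁ b' b - kernel M₂ b' b) X))‖
        ≤ ‖τ‖ * ‖NegSup.equiv (levWeight L η lev₀ 3) 𝔸 K b' * ((kernel M₁ b' b - kernel M₂ b' b) X)‖ := τ.le_opNorm _
      _ ≤ ‖τ‖ * (‖NegSup.equiv (levWeight L η lev₀ 3) 𝔸 K b'‖ * ‖(kernel M₁ b' b - kernel M₂ b' b) X‖) := by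
          gcongr; exact norm_mul_le _ _
      _ ≤ ‖τ‖ * (‖NegSup.equiv (levWeight L η lev₀ 3) 𝔸 K b'‖ * (‖kernel M₁ b' b - kernel M₂ b' b‖ * ‖X‖)) := by
          gcongr; exact (kernel M₁ b' b - kernel M₂ b' b).le_opNorm X
      _ = ‖τ‖ * ‖NegSup.equiv (levWeight L η lev₀ 3) 𝔸 K b'‖ * ‖kernel M₁ b' b - kernel M₂ b' b‖ * ‖X‖ := by ring
  rw [NegSup.equiv_sub, Pi.sub_apply, transCur_apply, transCur_apply, ← map_sub]
  calc levWeight L η lev₀ 3 b * ‖ρ (colFun τ M₁ K b - colFun τ M₂ K b)‖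
      ≤ levWeight L η lev₀ 3 b * (‖ρ‖ * ‖colFun τ M₁ K b - colFun τ M₂ K b‖) := mul_le_mul_of_nonneg_left (ρ.le_opNorm _) (hw b).le
    _ ≤ levWeight L η lev₀ 3 b * (‖ρ‖ * ∑ b' : Bond d Pd, ‖τ‖ * ‖NegSup.equiv (levWeight L η lev₀ 3) 𝔸 K b'‖ * ‖kernel M₁ b' b - kernel M₂ b' b‖) :=
        mul_le_mul_of_nonneg_left (mul_le_mul_of_nonneg_left hcol (norm_nonneg ρ)) (hw b).le
    _ ≤ levWeight L η lev₀ 3 b * (‖ρ‖ * ∑ b' : Bond d Pd, ‖τ‖ * (‖K‖ / levWeight L η lev₀ 3 b') * ‖kernel M₁ b' b - kernel M₂ b' b‖) :=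
        mul_le_mul_of_nonneg_left (mul_le_mul_of_nonneg_left (Finset.sum_le_sum fun b' _ =>
          mul_le_mul_of_nonneg_right (mul_le_mul_of_nonneg_left (hKb b') (norm_nonneg _)) (norm_nonneg _)) (norm_nonneg ρ)) (hw b).le
    _ = ‖ρ‖ * ‖τ‖ * (∑ b' : Bond d Pd, levWeight L η lev₀ 3 b / levWeight L η lev₀ 3 b' * ‖kernel M₁ b' b - kernel M₂ b' b‖) * ‖K‖ := by
        rw [Finset.mul_sum, Finset.mul_sum, Finset.mul_sum, Finset.sum_mul]
        refine Finset.sum_congr rfl fun b' _ => ?_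
        have h3 : levWeight L η lev₀ 3 b' ≠ 0 := (hw b').ne'
        field_simp
    _ ≤ ‖ρ‖ * ‖τ‖ * Θ * ‖K‖ := by gcongr; exact hΘ b

/-- **`‖M₁ᵗ(Δπ₁P₁) − M₂ᵗ(Δπ₂P₂)‖₍₋₃₎ ≤ ‖ρ‖‖τ‖·Θ′·‖P₁‖` THROUGH THE COLUMN LETTER OF THE COMPOSITE DIFFERENCE** — both `Δπ_i` (27)-symmetric on their
carrier (`B11Eq88TransposeComposite.colFun_apply_of_symm`), the two configurations with the same bond function (`flat115 P₂ = flat115 P₁`), and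
`Σ_{b′}(w₃(b)/w₁(b′))‖(Δπ₁(M₁δ_bX))(b′) − (Δπ₂(M₂δ_bX))(b′)‖ ≤ Θ′‖X‖`: the two-background twin of `B11Eq88TransposeComposite.norm_transCur_le_of_symm` — print's
transposed (88)-row without the letter `‖Δπ‖`. [cite: Balaban1985Variational, (88) p.291, (85) p.291, (27) p.282] -/
theorem norm_transCur_symm_sub_le (ρ : (𝔸 →L[ℂ] ℂ) →L[ℂ] 𝔸) (τ : 𝔸 →L[ℂ] ℂ)
    (M₁ : Space115 L η lev₀ lev₁ Dc₁ →L[ℂ] Space115 L η lev₀ lev₁ Dc₁) (M₂ : Space115 L η lev₀ lev₁ Dc₂ →L[ℂ] Space115 L η lev₀ lev₁ Dc₂)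
    (Δπ₁ : Space115 L η lev₀ lev₁ Dc₁ →L[ℂ] NegSize L η lev₀ 3 𝔸) (Δπ₂ : Space115 L η lev₀ lev₁ Dc₂ →L[ℂ] NegSize L η lev₀ 3 𝔸)
    (hsym₁ : ∀ Y₁ Y₂ : Space115 L η lev₀ lev₁ Dc₁,
      ∑ b' : Bond d Pd, τ (NegSup.equiv (levWeight L η lev₀ 3) 𝔸 (Δπ₁ Y₁) b' * flat115 Y₂ b') =
        ∑ b' : Bond d Pd, τ (NegSup.equiv (levWeight L η lev₀ 3) 𝔸 (Δπ₁ Y₂) b' * flat115 Y₁ b'))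
    (hsym₂ : ∀ Y₁ Y₂ : Space115 L η lev₀ lev₁ Dc₂,
      ∑ b' : Bond d Pd, τ (NegSup.equiv (levWeight L η lev₀ 3) 𝔸 (Δπ₂ Y₁) b' * flat115 Y₂ b') =
        ∑ b' : Bond d Pd, τ (NegSup.equiv (levWeight L η lev₀ 3) 𝔸 (Δπ₂ Y₂) b' * flat115 Y₁ b'))
    {Θ : ℝ} (hΘ0 : 0 ≤ Θ)
    (hΘ : ∀ (b : Bond d Pd) (X : 𝔸), ∑ b' : Bond d Pd, levWeight L η lev₀ 3 b / levWeight L η lev₀ 1 b' *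
      ‖NegSup.equiv (levWeight L η lev₀ 3) 𝔸 (Δπ₁ (M₁ (single115 b X))) b' - NegSup.equiv (levWeight L η lev₀ 3) 𝔸 (Δπ₂ (M₂ (single115 b X))) b'‖ ≤ Θ * ‖X‖)
    (P₁ : Space115 L η lev₀ lev₁ Dc₁) (P₂ : Space115 L η lev₀ lev₁ Dc₂) (hflat : flat115 P₂ = flat115 P₁) :
    ‖transCur ρ τ M₁ (Δπ₁ P₁) - transCur ρ τ M₂ (Δπ₂ P₂)‖ ≤ ‖ρ‖ * ‖τ‖ * Θ * ‖P₁‖ := by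
  rw [NegSup.norm_le_iff (by positivity)]
  intro b
  have hw3 : ∀ b : Bond d Pd, 0 < levWeight L η lev₀ 3 b := levWeight_pos (Fact.out : 0 < L) (Fact.out : 0 < η) lev₀ 3
  have hw1 : ∀ b : Bond d Pd, 0 < levWeight L η lev₀ 1 b := levWeight_pos (Fact.out : 0 < L) (Fact.out : 0 < η) lev₀ 1
  have hAb : ∀ b' : Bond d Pd, ‖flat115 P₁ b'‖ ≤ ‖P₁‖ / levWeight L η lev₀ 1 b' := fun b' => by
    rw [le_div_iff₀ (hw1 b'), mul_comm, flat115_apply]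
    exact JetSup.weight_mul_norm_apply_le P₁ b'
  -- the difference of the one-bond functionals through the composite kernels
  have hcol : ‖colFun τ M₁ (Δπ₁ P₁) b - colFun τ M₂ (Δπ₂ P₂) b‖ ≤ ‖τ‖ * ‖P₁‖ / levWeight L η lev₀ 3 b * Θ := by
    refine ContinuousLinearMap.opNorm_le_bound _ (by have := (hw3 b).le; positivity) fun X => ?_
    rw [sub_apply, colFun_apply_of_symm τ M₁ Δπ₁ hsym₁ P₁ b X, colFun_apply_of_symm τ M₂ Δπ₂ hsym₂ P₂ b X, hflat,
      ← Finset.sum_sub_distrib]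
    have e : ∀ b' : Bond d Pd, τ (NegSup.equiv (levWeight L η lev₀ 3) 𝔸 (Δπ₁ (M₁ (single115 b X))) b' * flat115 P₁ b') -
        τ (NegSup.equiv (levWeight L η lev₀ 3) 𝔸 (Δπ₂ (M₂ (single115 b X))) b' * flat115 P₁ b') =
        τ ((NegSup.equiv (levWeight L η lev₀ 3) 𝔸 (Δπ₁ (M₁ (single115 b X))) b' -
          NegSup.equiv (levWeight L η lev₀ 3) 𝔸 (Δπ₂ (M₂ (single115 b X))) b') * flat115 P₁ b') := fun b' => by
      rw [← map_sub, ← sub_mul]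
    simp only [e]
    calc ‖∑ b' : Bond d Pd, τ ((NegSup.equiv (levWeight L η lev₀ 3) 𝔸 (Δπ₁ (M₁ (single115 b X))) b' -
            NegSup.equiv (levWeight L η lev₀ 3) 𝔸 (Δπ₂ (M₂ (single115 b X))) b') * flat115 P₁ b')‖
        ≤ ∑ b' : Bond d Pd, ‖τ‖ * (‖NegSup.equiv (levWeight L η lev₀ 3) 𝔸 (Δπ₁ (M₁ (single115 b X))) b' -
            NegSup.equiv (levWeight L η lev₀ 3) 𝔸 (Δπ₂ (M₂ (single115 b X))) b'‖ * (‖P₁‖ / levWeight L η lev₀ 1 b')) :=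
          (norm_sum_le _ _).trans (Finset.sum_le_sum fun b' _ =>
            (τ.le_opNorm _).trans (mul_le_mul_of_nonneg_left ((norm_mul_le _ _).trans
              (mul_le_mul_of_nonneg_left (hAb b') (norm_nonneg _))) (norm_nonneg _)))
      _ = ‖τ‖ * ‖P₁‖ / levWeight L η lev₀ 3 b * ∑ b' : Bond d Pd, levWeight L η lev₀ 3 b / levWeight L η lev₀ 1 b' *
            ‖NegSup.equiv (levWeight L η lev₀ 3) 𝔸 (Δπ₁ (M₁ (single115 b X))) b' -
              NegSup.equiv (levWeight L η lev₀ 3) 𝔸 (Δπ₂ (M₂ (single115 b X))) b'‖ := by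
          rw [Finset.mul_sum]
          refine Finset.sum_congr rfl fun b' _ => ?_
          have h3 : levWeight L η lev₀ 3 b ≠ 0 := (hw3 b).ne'
          have h1 : levWeight L η lev₀ 1 b' ≠ 0 := (hw1 b').ne'
          field_simp
      _ ≤ ‖τ‖ * ‖P₁‖ / levWeight L η lev₀ 3 b * (Θ * ‖X‖) := by
          have : 0 ≤ ‖τ‖ * ‖P₁‖ / levWeight L η lev₀ 3 b := by have := (hw3 b).le; positivity
          exact mul_le_mul_of_nonneg_left (hΘ b X) this
      _ = ‖τ‖ * ‖P₁‖ / levWeight L η lev₀ 3 b * Θ * ‖X‖ := by ring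
  rw [NegSup.equiv_sub, Pi.sub_apply, transCur_apply, transCur_apply, ← map_sub]
  calc levWeight L η lev₀ 3 b * ‖ρ (colFun τ M₁ (Δπ₁ P₁) b - colFun τ M₂ (Δπ₂ P₂) b)‖
      ≤ levWeight L η lev₀ 3 b * (‖ρ‖ * ‖colFun τ M₁ (Δπ₁ P₁) b - colFun τ M₂ (Δπ₂ P₂) b‖) :=
        mul_le_mul_of_nonneg_left (ρ.le_opNorm _) (hw3 b).le
    _ ≤ levWeight L η lev₀ 3 b * (‖ρ‖ * (‖τ‖ * ‖P₁‖ / levWeight L η lev₀ 3 b * Θ)) :=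
        mul_le_mul_of_nonneg_left (mul_le_mul_of_nonneg_left hcol (norm_nonneg ρ)) (hw3 b).le
    _ = ‖ρ‖ * ‖τ‖ * Θ * ‖P₁‖ := by
        have h3 : levWeight L η lev₀ 3 b ≠ 0 := (hw3 b).ne'
        field_simp

variable {Dc : (Bond d Pd → 𝔸) →ₗ[ℂ] (κ' → 𝔸)}

/-- The kernel of `−M` is minus the kernel. [cite: Balaban1985Variational, (63) p.287] -/
theorem kernel_neg (M : Space115 L η lev₀ lev₁ Dc →L[ℂ] Space115 L η lev₀ lev₁ Dc) (b' b : Bond d Pd) :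
    kernel (-M) b' b = -kernel M b' b := by
  ext X; simp only [kernel_apply, neg_apply, map_neg, Pi.neg_apply]

end Transpose

/-! ## §2 The four groups of `W = (δ/δA′)V` at a pair of configurations, one per carrier, through the letters -/

section Groups

variable {𝒳 : Type*} [NormedAddCommGroup 𝒳] [NormedSpace ℂ 𝒳]
  {H₁ : 𝒳 →L[ℂ] Space115 L η lev₀ lev₁ Dc₁} {C₁ : Space115 L η lev₀ lev₁ Dc₁ → 𝒳}
  {H₂ : 𝒳 →L[ℂ] Space115 L η lev₀ lev₁ Dc₂} {C₂' : Space115 L η lev₀ lev₁ Dc₂ → 𝒳} {b C₂ c₄ aC εC : ℝ}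
  (ρ : (𝔸 →L[ℂ] ℂ) →L[ℂ] 𝔸) (τ : 𝔸 →L[ℂ] ℂ) {P₁ : Space115 L η lev₀ lev₁ Dc₁} {P₂ : Space115 L η lev₀ lev₁ Dc₂}

/-- **`T′₁(P₁) − T′₂(P₂)` HAS THE KERNEL COLUMNS OF `(HD)′₁(P₁) − (HD)′₂(P₂)`**: `T′ = 1 + (−HD)′` (`fderiv_T47`) on both carriers, the unit matrices cancel
(`kernel_id_apply`), `(−HD)′ = −(HD)′`. [cite: Balaban1985Variational, (47) p.285, (63) p.287, (90) p.291] -/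
theorem kernel_fderiv_T47_sub (RC₁ : Regime H₁ 0 C₁ b 0 C₂ c₄ 0 aC εC) (hC₁ : Prop4Hyp C₁ C₂ c₄) (RC₂ : Regime H₂ 0 C₂' b 0 C₂ c₄ 0 aC εC)
    (hC₂ : Prop4Hyp C₂' C₂ c₄) (hP₁ : ‖P₁‖ < aC) (hP₂ : ‖P₂‖ < aC) (b' bb : Bond d Pd) :
    ‖kernel (fderiv ℂ (T47 H₁ C₁ εC) P₁) b' bb - kernel (fderiv ℂ (T47 H₂ C₂' εC) P₂) b' bb‖ =
      ‖kernel (fderiv ℂ (Emap H₁ C₁ εC) P₁) b' bb - kernel (fderiv ℂ (Emap H₂ C₂' εC) P₂) b' bb‖ := by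
  have hs₁ : fderiv ℂ (solA H₁ 0 C₁ 0 εC) P₁ = -fderiv ℂ (Emap H₁ C₁ εC) P₁ := by
    rw [show Emap H₁ C₁ εC = -(solA H₁ 0 C₁ 0 εC) from rfl, fderiv_neg, neg_neg]
  have hs₂ : fderiv ℂ (solA H₂ 0 C₂' 0 εC) P₂ = -fderiv ℂ (Emap H₂ C₂' εC) P₂ := by
    rw [show Emap H₂ C₂' εC = -(solA H₂ 0 C₂' 0 εC) from rfl, fderiv_neg, neg_neg]
  have hid : kernel (ContinuousLinearMap.id ℂ (Space115 L η lev₀ lev₁ Dc₁)) b' bb = kernel (ContinuousLinearMap.id ℂ (Space115 L η lev₀ lev₁ Dc₂)) b' bb := by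
    ext X; rw [kernel_id_apply, kernel_id_apply]
  rw [fderiv_T47 RC₁ hC₁ hP₁, fderiv_T47 RC₂ hC₂ hP₂, kernel_add, kernel_add, hid, add_sub_add_left_eq_sub, hs₁, hs₂, kernel_neg, kernel_neg,
    ← neg_sub, norm_neg, neg_sub_neg, norm_sub_rev]

/-- **(85) AT THE PAIR**: `‖W₁(…₁)(P₁) − W₁(…₂)(P₂)‖₍₋₃₎ ≤ ‖ρ‖‖τ‖θ₃·(‖J₁‖‖P₁‖² + ‖J₂‖‖P₂‖²)` — both terms separately through the column letter `θ₃` of the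
kernel of `(HD₃)′` (`B11Eq98CurrentSlot.norm_W1_le`); the two currents `J₁, J₂` are letters (both small in the consumers: `J₁ = J(U)`, `‖J(U)‖ ≤ ω³j₀`; `J₂ = J(1)`).
[cite: Balaban1985Variational, (85)–(86) p.291, (28) p.282] -/
theorem norm_W1_sub_W1_le (J₁ J₂ : NegSize L η lev₀ 3 𝔸) {θ₃ : ℝ} (hθ₃ : 0 ≤ θ₃)
    (hΘ3₁ : ∀ bb : Bond d Pd, ∑ b' : Bond d Pd, levWeight L η lev₀ 3 bb / levWeight L η lev₀ 3 b' * ‖kernel (fderiv ℂ (E3 H₁ C₁ εC) P₁) b' bb‖ ≤ θ₃ * ‖P₁‖ ^ 2)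
    (hΘ3₂ : ∀ bb : Bond d Pd, ∑ b' : Bond d Pd, levWeight L η lev₀ 3 bb / levWeight L η lev₀ 3 b' * ‖kernel (fderiv ℂ (E3 H₂ C₂' εC) P₂) b' bb‖ ≤ θ₃ * ‖P₂‖ ^ 2) :
    ‖W1 ρ τ H₁ C₁ εC J₁ P₁ - W1 ρ τ H₂ C₂' εC J₂ P₂‖ ≤ ‖ρ‖ * ‖τ‖ * θ₃ * (‖J₁‖ * ‖P₁‖ ^ 2 + ‖J₂‖ * ‖P₂‖ ^ 2) := by
  have h1 := norm_W1_le ρ τ J₁ hθ₃ hΘ3₁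
  have h2 := norm_W1_le ρ τ J₂ hθ₃ hΘ3₂
  calc ‖W1 ρ τ H₁ C₁ εC J₁ P₁ - W1 ρ τ H₂ C₂' εC J₂ P₂‖ ≤ ‖W1 ρ τ H₁ C₁ εC J₁ P₁‖ + ‖W1 ρ τ H₂ C₂' εC J₂ P₂‖ := norm_sub_le _ _
    _ ≤ ‖ρ‖ * ‖τ‖ * θ₃ * ‖J₁‖ * ‖P₁‖ ^ 2 + ‖ρ‖ * ‖τ‖ * θ₃ * ‖J₂‖ * ‖P₂‖ ^ 2 := add_le_add h1 h2
    _ = ‖ρ‖ * ‖τ‖ * θ₃ * (‖J₁‖ * ‖P₁‖ ^ 2 + ‖J₂‖ * ‖P₂‖ ^ 2) := by ring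

/-- **THE ROW `Δ_π HD(A′)` AT THE PAIR THROUGH THE COMPOSITE LETTERS**: `Δπ₁(HD₁(P₁)) − Δπ₂(HD₂(P₂)) = (Δπ₁H₁ − Δπ₂H₂)(C₁(A₁)) + Δπ₂H₂(C₁(A₁) − C₂(A₂))`
(`HD_i = H_i∘C_i∘T_i`, (48)–(49)), so with the two-background letter `δN` of the composite `Δπ∘H`, the one-background `N₁` at carrier 2, (46) `‖C₁(A₁)‖ ≤ C₂‖A₁‖² ≤
C₂ℓ²‖P₁‖²` and the value modulus `‖C₁(T₁P₁) − C₂(T₂P₂)‖ ≤ δ_CT`: `≤ δN·C₂ℓ²‖P₁‖² + N₁·δ_CT`. [cite: Balaban1985Variational, (88) p.291, (46)–(49) p.285, (57) p.286] -/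
theorem norm_ΔπEmap_sub_le (RC₁ : Regime H₁ 0 C₁ b 0 C₂ c₄ 0 aC εC) (RC₂ : Regime H₂ 0 C₂' b 0 C₂ c₄ 0 aC εC)
    (Δπ₁ : Space115 L η lev₀ lev₁ Dc₁ →L[ℂ] NegSize L η lev₀ 3 𝔸) (Δπ₂ : Space115 L η lev₀ lev₁ Dc₂ →L[ℂ] NegSize L η lev₀ 3 𝔸)
    (hP₁ : ‖P₁‖ < aC) (hP₂ : ‖P₂‖ < aC) {N₁ δN δCT : ℝ} (hN₁0 : 0 ≤ N₁) (hδN0 : 0 ≤ δN)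
    (hN₂ : ∀ X : 𝒳, ‖Δπ₂ (H₂ X)‖ ≤ N₁ * ‖X‖) (hδN : ∀ X : 𝒳, ‖Δπ₁ (H₁ X) - Δπ₂ (H₂ X)‖ ≤ δN * ‖X‖)
    (hCT : ‖C₁ (T47 H₁ C₁ εC P₁) - C₂' (T47 H₂ C₂' εC P₂)‖ ≤ δCT) :
    ‖Δπ₁ (Emap H₁ C₁ εC P₁) - Δπ₂ (Emap H₂ C₂' εC P₂)‖ ≤ δN * (C₂ * (1 / (1 - 4 * b * C₂ * (εC + aC))) ^ 2 * ‖P₁‖ ^ 2) + N₁ * δCT := by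
  have hT : ‖T47 H₁ C₁ εC P₁‖ < c₄ := by
    have h := norm_T47_lt RC₁ hP₁
    linarith [RC₁.dom, RC₁.ε₄_nonneg, norm_nonneg (T47 H₁ C₁ εC P₁)]
  have hT' : ‖T47 H₁ C₁ εC P₁‖ ≤ 1 / (1 - 4 * b * C₂ * (εC + aC)) * ‖P₁‖ := by
    rw [one_div_mul_eq_div]; exact norm_T47_le RC₁ hP₁
  have hCA : ‖C₁ (T47 H₁ C₁ εC P₁)‖ ≤ C₂ * (1 / (1 - 4 * b * C₂ * (εC + aC))) ^ 2 * ‖P₁‖ ^ 2 := by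
    calc ‖C₁ (T47 H₁ C₁ εC P₁)‖ ≤ C₂ * ‖T47 H₁ C₁ εC P₁‖ ^ 2 := RC₁.quad.quad _ hT
      _ ≤ C₂ * (1 / (1 - 4 * b * C₂ * (εC + aC)) * ‖P₁‖) ^ 2 := by have := RC₁.C₄_nonneg; gcongr
      _ = _ := by ring
  have e : Δπ₁ (Emap H₁ C₁ εC P₁) - Δπ₂ (Emap H₂ C₂' εC P₂) =
      (Δπ₁ (H₁ (C₁ (T47 H₁ C₁ εC P₁))) - Δπ₂ (H₂ (C₁ (T47 H₁ C₁ εC P₁)))) + Δπ₂ (H₂ (C₁ (T47 H₁ C₁ εC P₁) - C₂' (T47 H₂ C₂' εC P₂))) := by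
    rw [Emap_eq_H RC₁ hP₁, Emap_eq_H RC₂ hP₂, map_sub, map_sub]; abel
  rw [e]
  calc _ ≤ ‖Δπ₁ (H₁ (C₁ (T47 H₁ C₁ εC P₁))) - Δπ₂ (H₂ (C₁ (T47 H₁ C₁ εC P₁)))‖ + ‖Δπ₂ (H₂ (C₁ (T47 H₁ C₁ εC P₁) - C₂' (T47 H₂ C₂' εC P₂)))‖ :=
        norm_add_le _ _
    _ ≤ δN * ‖C₁ (T47 H₁ C₁ εC P₁)‖ + N₁ * ‖C₁ (T47 H₁ C₁ εC P₁) - C₂' (T47 H₂ C₂' εC P₂)‖ := add_le_add (hδN _) (hN₂ _)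
    _ ≤ δN * (C₂ * (1 / (1 - 4 * b * C₂ * (εC + aC))) ^ 2 * ‖P₁‖ ^ 2) + N₁ * δCT := by gcongr

/-- **(87)–(88) AT THE PAIR**: `W₂(…₁)(P₁) − W₂(…₂)(P₂) = −[(Δπ₁HD₁P₁ − Δπ₂HD₂P₂) + ((HD)′₁ᵗ(Δπ₁P₁) − (HD)′₂ᵗ(Δπ₂P₂))]` — the first bracket by `norm_ΔπEmap_sub_le`,
the second through the COMPOSITE column letter `δθ′` of `Δπ₁∘(HD)′₁(P₁) − Δπ₂∘(HD)′₂(P₂)` (§1, both `Δπ_i` (27)-symmetric):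
`≤ (δN·C₂ℓ²‖P₁‖² + N₁δ_CT) + ‖ρ‖‖τ‖δθ′‖P₁‖`. [cite: Balaban1985Variational, (87)–(88) p.291, (27) p.282] -/
theorem norm_W2_sub_W2_le (RC₁ : Regime H₁ 0 C₁ b 0 C₂ c₄ 0 aC εC) (RC₂ : Regime H₂ 0 C₂' b 0 C₂ c₄ 0 aC εC)
    (Δπ₁ : Space115 L η lev₀ lev₁ Dc₁ →L[ℂ] NegSize L η lev₀ 3 𝔸) (Δπ₂ : Space115 L η lev₀ lev₁ Dc₂ →L[ℂ] NegSize L η lev₀ 3 𝔸)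
    (hsym₁ : ∀ Y₁ Y₂ : Space115 L η lev₀ lev₁ Dc₁,
      ∑ b' : Bond d Pd, τ (NegSup.equiv (levWeight L η lev₀ 3) 𝔸 (Δπ₁ Y₁) b' * flat115 Y₂ b') =
        ∑ b' : Bond d Pd, τ (NegSup.equiv (levWeight L η lev₀ 3) 𝔸 (Δπ₁ Y₂) b' * flat115 Y₁ b'))
    (hsym₂ : ∀ Y₁ Y₂ : Space115 L η lev₀ lev₁ Dc₂,
      ∑ b' : Bond d Pd, τ (NegSup.equiv (levWeight L η lev₀ 3) 𝔸 (Δπ₂ Y₁) b' * flat115 Y₂ b') =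
        ∑ b' : Bond d Pd, τ (NegSup.equiv (levWeight L η lev₀ 3) 𝔸 (Δπ₂ Y₂) b' * flat115 Y₁ b'))
    (hflat : flat115 P₂ = flat115 P₁) (hP₁ : ‖P₁‖ < aC) (hP₂ : ‖P₂‖ < aC) {N₁ δN δCT δθ' : ℝ} (hN₁0 : 0 ≤ N₁) (hδN0 : 0 ≤ δN) (hδθ'0 : 0 ≤ δθ')
    (hN₂ : ∀ X : 𝒳, ‖Δπ₂ (H₂ X)‖ ≤ N₁ * ‖X‖) (hδN : ∀ X : 𝒳, ‖Δπ₁ (H₁ X) - Δπ₂ (H₂ X)‖ ≤ δN * ‖X‖)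
    (hCT : ‖C₁ (T47 H₁ C₁ εC P₁) - C₂' (T47 H₂ C₂' εC P₂)‖ ≤ δCT)
    (hδΘ' : ∀ (bb : Bond d Pd) (X : 𝔸), ∑ b' : Bond d Pd, levWeight L η lev₀ 3 bb / levWeight L η lev₀ 1 b' *
      ‖NegSup.equiv (levWeight L η lev₀ 3) 𝔸 (Δπ₁ ((fderiv ℂ (Emap H₁ C₁ εC) P₁) (single115 bb X))) b' -
        NegSup.equiv (levWeight L η lev₀ 3) 𝔸 (Δπ₂ ((fderiv ℂ (Emap H₂ C₂' εC) P₂) (single115 bb X))) b'‖ ≤ δθ' * ‖X‖) :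
    ‖W2 ρ τ H₁ C₁ εC Δπ₁ P₁ - W2 ρ τ H₂ C₂' εC Δπ₂ P₂‖ ≤
      (δN * (C₂ * (1 / (1 - 4 * b * C₂ * (εC + aC))) ^ 2 * ‖P₁‖ ^ 2) + N₁ * δCT) + ‖ρ‖ * ‖τ‖ * δθ' * ‖P₁‖ := by
  have e : W2 ρ τ H₁ C₁ εC Δπ₁ P₁ - W2 ρ τ H₂ C₂' εC Δπ₂ P₂ =
      -((Δπ₁ (Emap H₁ C₁ εC P₁) - Δπ₂ (Emap H₂ C₂' εC P₂)) +
        (transCur ρ τ (fderiv ℂ (Emap H₁ C₁ εC) P₁) (Δπ₁ P₁) - transCur ρ τ (fderiv ℂ (Emap H₂ C₂' εC) P₂) (Δπ₂ P₂))) := by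
    rw [W2, W2]; abel
  rw [e, norm_neg]
  exact (norm_add_le _ _).trans (add_le_add (norm_ΔπEmap_sub_le RC₁ RC₂ Δπ₁ Δπ₂ hP₁ hP₂ hN₁0 hδN0 hN₂ hδN hCT)
    (norm_transCur_symm_sub_le ρ τ _ _ Δπ₁ Δπ₂ hsym₁ hsym₂ hδθ'0 hδΘ' P₁ P₂ hflat))

/-- **(89) AT THE PAIR**: `W₃(…₁)(P₁) − W₃(…₂)(P₂) = ((HD)′₁ᵗ − (HD)′₂ᵗ)(K₁) + (HD)′₂ᵗ(K₁ − K₂)`, `K_i = Δπ_iHD_i(P_i)`: the first term through the column letter `δθ_E` of the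
KERNEL DIFFERENCE `k_{(HD)′₁(P₁)} − k_{(HD)′₂(P₂)}` (§1) and `‖K₁‖ ≤ N₁C₂ℓ²‖P₁‖²` (`norm_Δπ_Emap_le`), the second through the one-background column letter `θ_E‖P₂‖` at
carrier 2 and `‖K₁ − K₂‖ ≤ δ_K` (`norm_ΔπEmap_sub_le`). [cite: Balaban1985Variational, (89) p.291, (73) p.289] -/
theorem norm_W3_sub_W3_le (RC₁ : Regime H₁ 0 C₁ b 0 C₂ c₄ 0 aC εC)
    (Δπ₁ : Space115 L η lev₀ lev₁ Dc₁ →L[ℂ] NegSize L η lev₀ 3 𝔸) (Δπ₂ : Space115 L η lev₀ lev₁ Dc₂ →L[ℂ] NegSize L η lev₀ 3 𝔸)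
    (hP₁ : ‖P₁‖ < aC) {N₁ θE δθE δK : ℝ} (hN₁0 : 0 ≤ N₁) (hθE : 0 ≤ θE) (hδθE0 : 0 ≤ δθE)
    (hN₁ : ∀ X : 𝒳, ‖Δπ₁ (H₁ X)‖ ≤ N₁ * ‖X‖)
    (hΘE₂ : ∀ bb : Bond d Pd, ∑ b' : Bond d Pd, levWeight L η lev₀ 3 bb / levWeight L η lev₀ 3 b' * ‖kernel (fderiv ℂ (Emap H₂ C₂' εC) P₂) b' bb‖ ≤ θE * ‖P₂‖)
    (hδΘE : ∀ bb : Bond d Pd, ∑ b' : Bond d Pd, levWeight L η lev₀ 3 bb / levWeight L η lev₀ 3 b' * ‖kernel (fderiv ℂ (Emap H₁ C₁ εC) P₁) b' bb - kernel (fderiv ℂ (Emap H₂ C₂' εC) P₂) b' bb‖ ≤ δθE)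
    (hK : ‖Δπ₁ (Emap H₁ C₁ εC P₁) - Δπ₂ (Emap H₂ C₂' εC P₂)‖ ≤ δK) :
    ‖W3 ρ τ H₁ C₁ εC Δπ₁ P₁ - W3 ρ τ H₂ C₂' εC Δπ₂ P₂‖ ≤
      ‖ρ‖ * ‖τ‖ * (δθE * (N₁ * C₂ * (1 / (1 - 4 * b * C₂ * (εC + aC))) ^ 2 * ‖P₁‖ ^ 2) + θE * ‖P₂‖ * δK) := by
  have e : W3 ρ τ H₁ C₁ εC Δπ₁ P₁ - W3 ρ τ H₂ C₂' εC Δπ₂ P₂ =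
      (transCur ρ τ (fderiv ℂ (Emap H₁ C₁ εC) P₁) (Δπ₁ (Emap H₁ C₁ εC P₁)) - transCur ρ τ (fderiv ℂ (Emap H₂ C₂' εC) P₂) (Δπ₁ (Emap H₁ C₁ εC P₁))) +
        transCur ρ τ (fderiv ℂ (Emap H₂ C₂' εC) P₂) (Δπ₁ (Emap H₁ C₁ εC P₁) - Δπ₂ (Emap H₂ C₂' εC P₂)) := by
    rw [W3, W3, map_sub]; abel
  rw [e]
  have h1 := norm_transCur_sub_transCur_le_of_kernel ρ τ (fderiv ℂ (Emap H₁ C₁ εC) P₁) (fderiv ℂ (Emap H₂ C₂' εC) P₂) hδθE0 hδΘE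
    (Δπ₁ (Emap H₁ C₁ εC P₁))
  have h2 := norm_transCur_le ρ τ (fderiv ℂ (Emap H₂ C₂' εC) P₂) (by positivity : 0 ≤ θE * ‖P₂‖) hΘE₂ (Δπ₁ (Emap H₁ C₁ εC P₁) - Δπ₂ (Emap H₂ C₂' εC P₂))
  have hK₁ := norm_Δπ_Emap_le RC₁ Δπ₁ hN₁0 hN₁ hP₁
  have hc : 0 ≤ ‖ρ‖ * ‖τ‖ := by positivity
  calc _ ≤ ‖transCur ρ τ (fderiv ℂ (Emap H₁ C₁ εC) P₁) (Δπ₁ (Emap H₁ C₁ εC P₁)) - transCur ρ τ (fderiv ℂ (Emap H₂ C₂' εC) P₂) (Δπ₁ (Emap H₁ C₁ εC P₁))‖ +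
        ‖transCur ρ τ (fderiv ℂ (Emap H₂ C₂' εC) P₂) (Δπ₁ (Emap H₁ C₁ εC P₁) - Δπ₂ (Emap H₂ C₂' εC P₂))‖ := norm_add_le _ _
    _ ≤ ‖ρ‖ * ‖τ‖ * δθE * ‖Δπ₁ (Emap H₁ C₁ εC P₁)‖ + ‖ρ‖ * ‖τ‖ * (θE * ‖P₂‖) * ‖Δπ₁ (Emap H₁ C₁ εC P₁) - Δπ₂ (Emap H₂ C₂' εC P₂)‖ :=
        add_le_add h1 h2
    _ ≤ ‖ρ‖ * ‖τ‖ * δθE * (N₁ * C₂ * (1 / (1 - 4 * b * C₂ * (εC + aC))) ^ 2 * ‖P₁‖ ^ 2) + ‖ρ‖ * ‖τ‖ * (θE * ‖P₂‖) * δK := by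
        gcongr
    _ = _ := by ring

/-- **(90)–(96) AT THE PAIR**: the composed V₀-group `(T′(A′))ᵗcurV0(TA′)`: `= (T′₁ᵗ − T′₂ᵗ)(V₁) + T′₂ᵗ(V₁ − V₂)`, `V_i = curV0_i(T_iP_i)`; the first term through
`δθ_E` (`kernel_fderiv_T47_sub`: the kernels of `T′₁ − T′₂` ARE those of `(HD)′₂ − (HD)′₁`) and `‖V₁‖ ≤ n_V`, the second through the column `≤ 1 + θ_E‖P₂‖` of `T′₂`
(`colSum_kernel_fderiv_T47_le`) and the value modulus `‖V₁ − V₂‖ ≤ δ_VT`. [cite: Balaban1985Variational, (90) p.291, (91)–(96) p.292] -/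
theorem norm_curV0full_sub_curV0full_le (RC₁ : Regime H₁ 0 C₁ b 0 C₂ c₄ 0 aC εC) (hC₁ : Prop4Hyp C₁ C₂ c₄)
    (RC₂ : Regime H₂ 0 C₂' b 0 C₂ c₄ 0 aC εC) (hC₂ : Prop4Hyp C₂' C₂ c₄) (U₁ U₂ : Bond d Pd → 𝔸ˣ) (hP₁ : ‖P₁‖ < aC) (hP₂ : ‖P₂‖ < aC)
    {θE δθE nV δVT : ℝ} (hθE : 0 ≤ θE) (hδθE0 : 0 ≤ δθE)
    (hΘE₂ : ∀ bb : Bond d Pd, ∑ b' : Bond d Pd, levWeight L η lev₀ 3 bb / levWeight L η lev₀ 3 b' * ‖kernel (fderiv ℂ (Emap H₂ C₂' εC) P₂) b' bb‖ ≤ θE * ‖P₂‖)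
    (hδΘE : ∀ bb : Bond d Pd, ∑ b' : Bond d Pd, levWeight L η lev₀ 3 bb / levWeight L η lev₀ 3 b' * ‖kernel (fderiv ℂ (Emap H₁ C₁ εC) P₁) b' bb - kernel (fderiv ℂ (Emap H₂ C₂' εC) P₂) b' bb‖ ≤ δθE)
    (hnV : ‖curV0 (lev₁ := lev₁) (Dc := Dc₁) ρ τ U₁ (T47 H₁ C₁ εC P₁)‖ ≤ nV)
    (hVT : ‖curV0 (lev₁ := lev₁) (Dc := Dc₁) ρ τ U₁ (T47 H₁ C₁ εC P₁) - curV0 (lev₁ := lev₁) (Dc := Dc₂) ρ τ U₂ (T47 H₂ C₂' εC P₂)‖ ≤ δVT) :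
    ‖curV0full ρ τ U₁ H₁ C₁ εC P₁ - curV0full ρ τ U₂ H₂ C₂' εC P₂‖ ≤ ‖ρ‖ * ‖τ‖ * (δθE * nV + (1 + θE * ‖P₂‖) * δVT) := by
  have e : curV0full ρ τ U₁ H₁ C₁ εC P₁ - curV0full ρ τ U₂ H₂ C₂' εC P₂ =
      (transCur ρ τ (fderiv ℂ (T47 H₁ C₁ εC) P₁) (curV0 (lev₁ := lev₁) (Dc := Dc₁) ρ τ U₁ (T47 H₁ C₁ εC P₁)) -
          transCur ρ τ (fderiv ℂ (T47 H₂ C₂' εC) P₂) (curV0 (lev₁ := lev₁) (Dc := Dc₁) ρ τ U₁ (T47 H₁ C₁ εC P₁))) +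
        transCur ρ τ (fderiv ℂ (T47 H₂ C₂' εC) P₂)
          (curV0 (lev₁ := lev₁) (Dc := Dc₁) ρ τ U₁ (T47 H₁ C₁ εC P₁) - curV0 (lev₁ := lev₁) (Dc := Dc₂) ρ τ U₂ (T47 H₂ C₂' εC P₂)) := by
    rw [curV0full_apply, curV0full_apply, map_sub]; abel
  rw [e]
  -- the kernel of `(solA)′₂ = −(Emap)′₂` has the same columns as that of `(Emap)′₂`
  have hΘsol : ∀ bb : Bond d Pd, ∑ b' : Bond d Pd, levWeight L η lev₀ 3 bb / levWeight L η lev₀ 3 b' * ‖kernel (fderiv ℂ (solA H₂ 0 C₂' 0 εC) P₂) b' bb‖ ≤ θE * ‖P₂‖ := fun bb => by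
    have hs : fderiv ℂ (solA H₂ 0 C₂' 0 εC) P₂ = -fderiv ℂ (Emap H₂ C₂' εC) P₂ := by
      rw [show Emap H₂ C₂' εC = -(solA H₂ 0 C₂' 0 εC) from rfl, fderiv_neg, neg_neg]
    simp only [hs, kernel_neg, norm_neg]
    exact hΘE₂ bb
  have hδT : ∀ bb : Bond d Pd, ∑ b' : Bond d Pd, levWeight L η lev₀ 3 bb / levWeight L η lev₀ 3 b' * ‖kernel (fderiv ℂ (T47 H₁ C₁ εC) P₁) b' bb - kernel (fderiv ℂ (T47 H₂ C₂' εC) P₂) b' bb‖ ≤ δθE := fun bb => by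
    simp only [kernel_fderiv_T47_sub RC₁ hC₁ RC₂ hC₂ hP₁ hP₂]
    exact hδΘE bb
  have h1 := norm_transCur_sub_transCur_le_of_kernel ρ τ (fderiv ℂ (T47 H₁ C₁ εC) P₁) (fderiv ℂ (T47 H₂ C₂' εC) P₂) hδθE0 hδT
    (curV0 (lev₁ := lev₁) (Dc := Dc₁) ρ τ U₁ (T47 H₁ C₁ εC P₁))
  have h2 := norm_transCur_le ρ τ (fderiv ℂ (T47 H₂ C₂' εC) P₂) (by positivity : 0 ≤ 1 + θE * ‖P₂‖)
    (fun bb => colSum_kernel_fderiv_T47_le RC₂ hC₂ hP₂ hΘsol bb)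
    (curV0 (lev₁ := lev₁) (Dc := Dc₁) ρ τ U₁ (T47 H₁ C₁ εC P₁) - curV0 (lev₁ := lev₁) (Dc := Dc₂) ρ τ U₂ (T47 H₂ C₂' εC P₂))
  have hc : 0 ≤ ‖ρ‖ * ‖τ‖ := by positivity
  calc _ ≤ ‖transCur ρ τ (fderiv ℂ (T47 H₁ C₁ εC) P₁) (curV0 (lev₁ := lev₁) (Dc := Dc₁) ρ τ U₁ (T47 H₁ C₁ εC P₁)) -
          transCur ρ τ (fderiv ℂ (T47 H₂ C₂' εC) P₂) (curV0 (lev₁ := lev₁) (Dc := Dc₁) ρ τ U₁ (T47 H₁ C₁ εC P₁))‖ +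
        ‖transCur ρ τ (fderiv ℂ (T47 H₂ C₂' εC) P₂)
          (curV0 (lev₁ := lev₁) (Dc := Dc₁) ρ τ U₁ (T47 H₁ C₁ εC P₁) - curV0 (lev₁ := lev₁) (Dc := Dc₂) ρ τ U₂ (T47 H₂ C₂' εC P₂))‖ := norm_add_le _ _
    _ ≤ ‖ρ‖ * ‖τ‖ * δθE * ‖curV0 (lev₁ := lev₁) (Dc := Dc₁) ρ τ U₁ (T47 H₁ C₁ εC P₁)‖ +
        ‖ρ‖ * ‖τ‖ * (1 + θE * ‖P₂‖) *
          ‖curV0 (lev₁ := lev₁) (Dc := Dc₁) ρ τ U₁ (T47 H₁ C₁ εC P₁) - curV0 (lev₁ := lev₁) (Dc := Dc₂) ρ τ U₂ (T47 H₂ C₂' εC P₂)‖ := add_le_add h1 h2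
    _ ≤ ‖ρ‖ * ‖τ‖ * δθE * nV + ‖ρ‖ * ‖τ‖ * (1 + θE * ‖P₂‖) * δVT := by gcongr
    _ = _ := by ring

/-- **THE BACKGROUND MODULUS OF `W = (δ/δA′)V` AT A PAIR OF CONFIGURATIONS WITH THE SAME BOND FUNCTION, THROUGH THE LETTERS** — the four groups summed
(`W80 = W1 + W2 + W3 + curV0full`): `‖W80(…₁)(P₁) − W80(…₂)(P₂)‖₍₋₃₎ ≤` W₁-bound + W₂-bound + W₃-bound + V₀-bound of this §, every letter displayed; the
consumers take `P₂ = ιP₁` and the lattice-free suppliers of `δN, δ_CT, δθ′, δθ_E, δ_VT`. [cite: Balaban1985Variational, (84) p.290, (85)–(96) pp.291–292, Prop. 4 (97)–(98) pp.292–293] -/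
theorem norm_W80_sub_W80_le_pair [CompleteSpace 𝔸] (RC₁ : Regime H₁ 0 C₁ b 0 C₂ c₄ 0 aC εC) (hC₁ : Prop4Hyp C₁ C₂ c₄)
    (RC₂ : Regime H₂ 0 C₂' b 0 C₂ c₄ 0 aC εC) (hC₂ : Prop4Hyp C₂' C₂ c₄) (U₁ U₂ : Bond d Pd → 𝔸ˣ) (J₁ J₂ : NegSize L η lev₀ 3 𝔸)
    (Δπ₁ : Space115 L η lev₀ lev₁ Dc₁ →L[ℂ] NegSize L η lev₀ 3 𝔸) (Δπ₂ : Space115 L η lev₀ lev₁ Dc₂ →L[ℂ] NegSize L η lev₀ 3 𝔸)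
    (hsym₁ : ∀ Y₁ Y₂ : Space115 L η lev₀ lev₁ Dc₁,
      ∑ b' : Bond d Pd, τ (NegSup.equiv (levWeight L η lev₀ 3) 𝔸 (Δπ₁ Y₁) b' * flat115 Y₂ b') =
        ∑ b' : Bond d Pd, τ (NegSup.equiv (levWeight L η lev₀ 3) 𝔸 (Δπ₁ Y₂) b' * flat115 Y₁ b'))
    (hsym₂ : ∀ Y₁ Y₂ : Space115 L η lev₀ lev₁ Dc₂,
      ∑ b' : Bond d Pd, τ (NegSup.equiv (levWeight L η lev₀ 3) 𝔸 (Δπ₂ Y₁) b' * flat115 Y₂ b') =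
        ∑ b' : Bond d Pd, τ (NegSup.equiv (levWeight L η lev₀ 3) 𝔸 (Δπ₂ Y₂) b' * flat115 Y₁ b'))
    (hflat : flat115 P₂ = flat115 P₁) (hP₁ : ‖P₁‖ < aC) (hP₂ : ‖P₂‖ < aC)
    {θ₃ θE N₁ δN δCT δθ' δθE nV δVT : ℝ} (hθ₃ : 0 ≤ θ₃) (hθE : 0 ≤ θE) (hN₁0 : 0 ≤ N₁) (hδN0 : 0 ≤ δN) (hδθ'0 : 0 ≤ δθ') (hδθE0 : 0 ≤ δθE)
    (hΘ3₁ : ∀ bb : Bond d Pd, ∑ b' : Bond d Pd, levWeight L η lev₀ 3 bb / levWeight L η lev₀ 3 b' * ‖kernel (fderiv ℂ (E3 H₁ C₁ εC) P₁) b' bb‖ ≤ θ₃ * ‖P₁‖ ^ 2)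
    (hΘ3₂ : ∀ bb : Bond d Pd, ∑ b' : Bond d Pd, levWeight L η lev₀ 3 bb / levWeight L η lev₀ 3 b' * ‖kernel (fderiv ℂ (E3 H₂ C₂' εC) P₂) b' bb‖ ≤ θ₃ * ‖P₂‖ ^ 2)
    (hΘE₂ : ∀ bb : Bond d Pd, ∑ b' : Bond d Pd, levWeight L η lev₀ 3 bb / levWeight L η lev₀ 3 b' * ‖kernel (fderiv ℂ (Emap H₂ C₂' εC) P₂) b' bb‖ ≤ θE * ‖P₂‖)
    (hN₁ : ∀ X : 𝒳, ‖Δπ₁ (H₁ X)‖ ≤ N₁ * ‖X‖) (hN₂ : ∀ X : 𝒳, ‖Δπ₂ (H₂ X)‖ ≤ N₁ * ‖X‖)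
    (hδN : ∀ X : 𝒳, ‖Δπ₁ (H₁ X) - Δπ₂ (H₂ X)‖ ≤ δN * ‖X‖)
    (hCT : ‖C₁ (T47 H₁ C₁ εC P₁) - C₂' (T47 H₂ C₂' εC P₂)‖ ≤ δCT)
    (hδΘ' : ∀ (bb : Bond d Pd) (X : 𝔸), ∑ b' : Bond d Pd, levWeight L η lev₀ 3 bb / levWeight L η lev₀ 1 b' *
      ‖NegSup.equiv (levWeight L η lev₀ 3) 𝔸 (Δπ₁ ((fderiv ℂ (Emap H₁ C₁ εC) P₁) (single115 bb X))) b' -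
        NegSup.equiv (levWeight L η lev₀ 3) 𝔸 (Δπ₂ ((fderiv ℂ (Emap H₂ C₂' εC) P₂) (single115 bb X))) b'‖ ≤ δθ' * ‖X‖)
    (hδΘE : ∀ bb : Bond d Pd, ∑ b' : Bond d Pd, levWeight L η lev₀ 3 bb / levWeight L η lev₀ 3 b' * ‖kernel (fderiv ℂ (Emap H₁ C₁ εC) P₁) b' bb - kernel (fderiv ℂ (Emap H₂ C₂' εC) P₂) b' bb‖ ≤ δθE)
    (hnV : ‖curV0 (lev₁ := lev₁) (Dc := Dc₁) ρ τ U₁ (T47 H₁ C₁ εC P₁)‖ ≤ nV)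
    (hVT : ‖curV0 (lev₁ := lev₁) (Dc := Dc₁) ρ τ U₁ (T47 H₁ C₁ εC P₁) - curV0 (lev₁ := lev₁) (Dc := Dc₂) ρ τ U₂ (T47 H₂ C₂' εC P₂)‖ ≤ δVT) :
    ‖W80 ρ τ U₁ H₁ C₁ εC J₁ Δπ₁ P₁ - W80 ρ τ U₂ H₂ C₂' εC J₂ Δπ₂ P₂‖ ≤
      ‖ρ‖ * ‖τ‖ * θ₃ * (‖J₁‖ * ‖P₁‖ ^ 2 + ‖J₂‖ * ‖P₂‖ ^ 2) +
        ((δN * (C₂ * (1 / (1 - 4 * b * C₂ * (εC + aC))) ^ 2 * ‖P₁‖ ^ 2) + N₁ * δCT) + ‖ρ‖ * ‖τ‖ * δθ' * ‖P₁‖) +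
        ‖ρ‖ * ‖τ‖ * (δθE * (N₁ * C₂ * (1 / (1 - 4 * b * C₂ * (εC + aC))) ^ 2 * ‖P₁‖ ^ 2) +
          θE * ‖P₂‖ * (δN * (C₂ * (1 / (1 - 4 * b * C₂ * (εC + aC))) ^ 2 * ‖P₁‖ ^ 2) + N₁ * δCT)) +
        ‖ρ‖ * ‖τ‖ * (δθE * nV + (1 + θE * ‖P₂‖) * δVT) := by
  have e : W80 ρ τ U₁ H₁ C₁ εC J₁ Δπ₁ P₁ - W80 ρ τ U₂ H₂ C₂' εC J₂ Δπ₂ P₂ =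
      (W1 ρ τ H₁ C₁ εC J₁ P₁ - W1 ρ τ H₂ C₂' εC J₂ P₂) + (W2 ρ τ H₁ C₁ εC Δπ₁ P₁ - W2 ρ τ H₂ C₂' εC Δπ₂ P₂) +
        (W3 ρ τ H₁ C₁ εC Δπ₁ P₁ - W3 ρ τ H₂ C₂' εC Δπ₂ P₂) + (curV0full ρ τ U₁ H₁ C₁ εC P₁ - curV0full ρ τ U₂ H₂ C₂' εC P₂) := by
    rw [W80, W80]; abel
  rw [e]
  have h₁ := norm_W1_sub_W1_le ρ τ J₁ J₂ hθ₃ hΘ3₁ hΘ3₂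
  have h₂ := norm_W2_sub_W2_le ρ τ RC₁ RC₂ Δπ₁ Δπ₂ hsym₁ hsym₂ hflat hP₁ hP₂ hN₁0 hδN0 hδθ'0 hN₂ hδN hCT hδΘ'
  have h₃ := norm_W3_sub_W3_le ρ τ (C₂' := C₂') RC₁ Δπ₁ Δπ₂ hP₁ hN₁0 hθE hδθE0 hN₁ hΘE₂ hδΘE
    (norm_ΔπEmap_sub_le RC₁ RC₂ Δπ₁ Δπ₂ hP₁ hP₂ hN₁0 hδN0 hN₂ hδN hCT)
  have h₄ := norm_curV0full_sub_curV0full_le ρ τ RC₁ hC₁ RC₂ hC₂ U₁ U₂ hP₁ hP₂ hθE hδθE0 hΘE₂ hδΘE hnV hVT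
  exact (norm_add_le _ _).trans (add_le_add ((norm_add_le _ _).trans (add_le_add ((norm_add_le _ _).trans (add_le_add h₁ h₂)) h₃)) h₄)

end Groups

end Literature.MathematicalPhysics.QuantumFieldTheory.Balaban1983to89.B11Eq98W80TwoBackgroundLetters

end
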